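import Literature.AlgebraicGeometry.Resolution.InseparableLocalUniformizationHeightStepTwo
import Literature.AlgebraicGeometry.Resolution.InseparableLocalUniformizationAbhyankar
import Literature.AlgebraicGeometry.Resolution.TranscendentallyImmediate
import Literature.AlgebraicGeometry.Resolution.ValuedFunctionFieldsLemmas
import Literature.FieldTheory.Separability.FormallySmoothAlgebraic
import HarnessLib

/-!
# Inseparable local uniformization: the induction on the height (§4.2) from its printed inputs

Topic: `Literature/AlgebraicGeometry/Resolution`. M. Temkin, *Inseparable local uniformization*,
J. Algebra 373 (2013) 65–119 = arXiv:0804.1554v3 (numbering of this version; §4.2 = pp. 50–51,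
pp. 30–31 of the 41-pp. copy held in the literature store). This file completes the programme of
`InseparableLocalUniformizationEngine.lean` for §4.2: the packaged named fact
`Temkin2013HeightStepOfDescent` ("§4.2 with its printed inputs", `InseparableLocalUniformizationDescent.lean`)
is PROVED from the printed results it invokes —

* Thm. 4.1.1 (`Temkin2013Descent`, its own hypothesis),
* Lemma 3.3.2 (`Temkin2013_Lemma332`, `InseparableLocalUniformizationLemmas.lean`),
* Steps 3–4 of the proof of Thm. 4.1.1 (`Temkin2013_Steps34`, `InseparableLocalUniformizationEngine.lean`),
* Matsumura, *Commutative Ring Theory*, Thm. 26.9 (`Matsumura1987_26_9`, the dictionary "simple =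
  separable residue field = `0`-smooth", `InseparableLocalUniformizationHeightStepTwo.lean`) —

by formalizing Steps 0–2 of §4.2: Step 2 is `relConclusion_of_normalForm`
(`InseparableLocalUniformizationHeightStepTwo.lean`); Step 1 and the assembly are here:

* `relHeightLE_succ` — PROVED: the induction step. Given the corrected relative Thm. 1.3.2 in
  height `≤ n` (`Temkin2013RelHeightLE n`), for `K°` of height `≤ n + 1`: if the height is `≤ n`
  there is nothing to do; otherwise ("Let `F°` be the localization of `K°` whose height is
  `h - 1`") take the immediate coarsening `O₁ = F°` (`exists_minimal_overring`,
  `ringKrullDim_le_of_lt`); Step 1: "Choose a subset `b ⊂ F°` such that … `b̃` is a transcendence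
  basis of `F̃` over `k` … `F°` contains a subfield `k̄ = k(b)`"
  (`exists_intermediateField_valuation_eq_one_isResiduallyAlgebraicOver`), "choose `Y` to be any
  affine `k`-model of `k̄°` … refining `X` we can assume that `i` induces a morphism `X → Y`"
  (`exists_affineModel`, `exists_normal_affineModel_ge'`), "`x` is a closed point of `X_η`"
  (`centreIdeal_isMaximal_of_isResiduallyAlgebraicOver`), "the induction assumption applies to
  the `k̄`-variety `X_η` and the valued field `F`" (`IH` for `(k̄, K, F°, k̄[A])`), "any refinement
  `X′_η → X_η` … can be extended to a refinement `X′ → X`" (`exists_refinement_adjoin_eq`), "we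
  simply replace `k̄, K, X` and `Y` with `l, L, Nr_L(X)` and `Nr_l(Y)`"
  (`exists_integralClosure_model` twice; the generic fibre of `Nr_L(X′)` over `l` is
  `Nr_L(X′_η)`, `exists_mul_isIntegral_of_isIntegral_map_adjoin`; the new base `l°` has height
  one by purely inseparable invariance; the residue field stays algebraic,
  `isResiduallyAlgebraicOver_of_isPurelyInseparable`; the centre stays closed, smooth, and — by
  Matsumura 26.9 applied to the algebraic extension `k(𝔭)/l` — separable); then Step 2
  (`relConclusion_of_normalForm`) for `(k, L, L°, Nr_L(X′))` and the Step-0 transports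
  (`Temkin2013RelConclusion.of_purelyInseparable_right`, `.of_le`) conclude for `(k, K, K°, X)`.
* `Temkin2013HeightStepOfDescent.of_lemma332_steps34` — hence the packaged §4.2 fact follows
  from Lemma 3.3.2, Steps 3–4 and Matsumura 26.9; `Temkin2013HeightStep.of_descent_lemma332_steps34`;
  and the assembled frontier of the corrected Thm. 1.3.2: `Temkin2013Relative.of_descent_printed`
  (`Temkin2013Descent`, Lemma 3.3.2, Steps 3–4, Matsumura 26.9) and, combined with
  `InseparableLocalUniformizationAbhyankar.lean`, `Temkin2013Relative.of_printed_frontier`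
  (Thm. 5.5.2 (i), `Temkin2013DescentDefectStep`, Lemma 3.3.2, Steps 3–4, Matsumura 26.9); same
  for the absolute `Temkin2013`.

## The corrected Lemma 3.3.2 and the discharged dictionary (non-vacuous frontier)

The tree's first rendering `Temkin2013_Lemma332` of Lemma 3.3.2 lacks the printed hypothesis
"`X → S` of normalized finite type" and is refutable (see
`InseparableLocalUniformizationDecompletion.lean`, which vendors the corrected rendering
`Temkin2013_Lemma332_nft`), so every theorem above that takes `(h332 : Temkin2013_Lemma332)` has
an unsatisfiable hypothesis. The induction is therefore carried out against the corrected fact: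

* `Matsumura1987_26_9_holds` — PROVED: the named fact `Matsumura1987_26_9` (Matsumura, Thm. 26.9,
  algebraic case) is DISCHARGED by `Literature.FieldTheory.Separability.formallySmooth_iff_isSeparable_of_isAlgebraic`
  (`Literature/FieldTheory/Separability/FormallySmoothAlgebraic.lean`).
* `relHeightLE_succ_nft_of_matsumura`, `relHeightLE_succ_nft` — PROVED: the induction step from
  `Temkin2013_Lemma332_nft` (via `relConclusion_of_normalForm_nft`, whose extra finiteness
  hypothesis "`K/k` finitely generated" is available throughout), with resp. without the
  Matsumura hypothesis; `relHeightLE_succ` (old signature) is the special case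
  `Temkin2013_Lemma332 → Temkin2013_Lemma332_nft`.
* `Temkin2013HeightStepOfDescent.of_lemma332nft_steps34`,
  `Temkin2013HeightStep.of_descent_lemma332nft_steps34`, `Temkin2013Relative.of_descent_nft`,
  `Temkin2013Relative.of_nft_frontier`, `Temkin2013.of_nft_frontier`,
  `Temkin2013HeightStepOfDescent.of_lemma332_steps34'` — PROVED: the packaged §4.2 fact and the
  frontier of the corrected Thm. 1.3.2 with Lemma 3.3.2 in its corrected rendering and WITHOUT the
  Matsumura hypothesis: `{Temkin2013Abhyankar (Thm. 5.5.2 (i)), Temkin2013DescentDefectStep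
  (§4.1, Steps 1–4, resting on Thm. 3.3.1), Temkin2013_Lemma332_nft (Lemma 3.3.2),
  Temkin2013_Steps34 (Steps 3–4 of the proof of Thm. 4.1.1)}`.

## STATUS (verdict clean-up, 2026-08-16): `Temkin2013_Steps34` is deprecated

The named fact `Temkin2013_Steps34` taken (as `h34`) by the induction step and by every frontier
theorem of this file is MIS-RENDERED (its binders `[Algebra k̄ K₁] [IsScalarTower k̄ K K₁]` leave
the `k̄`-structure of `K₁` arbitrary, the tower hypothesis being the automatic one for the action
inherited from `K`) and is DEPRECATED in `InseparableLocalUniformizationEngine.lean` (statement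
kept verbatim); its corrected rendering `Temkin2013_Steps34_tower`
(`InseparableLocalUniformizationEngineTower.lean`) is PROVED (`Temkin2013_Steps34_tower_holds`,
`…StepsThreeFourHolds.lean`), and so is Lemma 3.3.2 (`Temkin2013_Lemma332_nft_holds`,
`DecompletionRoof.lean`). The induction has been re-run on the corrected fact in
`InseparableLocalUniformizationHeightInductionTower.lean` (`relHeightLE_succ_nft_tower`,
`Temkin2013HeightStepOfDescent.of_lemma332nft_steps34tower`,
`Temkin2013Relative.of_frontier₅_tower`, `Temkin2013.of_frontier₅_tower`,
`Temkin2013HeightStep.of_frontier₅_tower`, …) and made free of both hypotheses downstream: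
`Temkin2013HeightStepOfDescent_holds` (`…HeightStepOfDescentHolds.lean`), `…HeightStepFinal.lean`,
`…HeightStepTrustBase.lean`, `…RelativeTrustBase.lean`. The fifteen declarations below naming
`Temkin2013_Steps34` are kept under their ledger-referenced names as a legacy layer, each
switching `linter.deprecated` off for itself alone; the Step-1 bricks of `section prelim` and
`Matsumura1987_26_9_holds` are unaffected and remain in use (imported by
`…HeightInductionTower.lean`).

## Source

* M. Temkin, *Inseparable local uniformization*, arXiv:0804.1554v3, §4.2, Steps 0–2 (pp. 50–51).
* H. Matsumura, *Commutative Ring Theory*, Thm. 26.9 (p. 222 of the held copy).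
-/

noncomputable section

open IsLocalRing

namespace Literature.AlgebraicGeometry.Resolution

universe u

section prelim

variable {k : Type u} [Field k]

/-- **Normalization in a finite extension is an affine model** (Temkin 2013, §4.2, Step 1,
p. 50: "replace `k̄, K, X` and `Y` with `l, L, Nr_L(X)` and `Nr_l(Y)`"): for a finite extension
`E/F`, a valuation ring `E°` of `E` and an affine `k`-model `B₀ ⊆ E° ∩ F` of fraction field `F`,
the integral closure `Nr_E(B₀)` is (the underlying set of) a finitely generated `k`-subalgebra of
`E` (E. Noether, `NoetherFiniteIntegralClosure_holds`), contained in `E°`, with fraction field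
`E`, and integrally closed in `E`. PROVED. [cite: Temkin2013, Section 4.2, Step 1 (p. 50)] -/
theorem exists_integralClosure_model {F E : Type u} [Field F] [Field E] [Algebra k F] [Algebra F E]
    [Algebra k E] [IsScalarTower k F E] [FiniteDimensional F E] (O_E : ValuationSubring E)
    (B₀ : Subalgebra k F) (hB₀O : ∀ b : B₀, algebraMap F E b ∈ O_E) (hB₀fg : B₀.FG)
    (hB₀fr : IsFractionRing B₀ F) :
    ∃ B' : Subalgebra k E, B'.FG ∧ IsFractionRing B' E ∧ B'.toSubring ≤ O_E.toSubring ∧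
      (∀ y : E, y ∈ B' ↔ IsIntegral B₀ y) ∧ (∀ y : E, IsIntegral B' y → y ∈ B') := by
  haveI : Algebra.FiniteType k B₀ := B₀.fg_iff_finiteType.mp hB₀fg
  haveI : IsFractionRing B₀ F := hB₀fr
  haveI : Module.Finite B₀ (integralClosure B₀ E) := NoetherFiniteIntegralClosure_holds k B₀ F E
  refine ⟨(integralClosure B₀ E).restrictScalars k, ?_, ?_, ?_, fun y => Iff.rfl, ?_⟩
  · have : Algebra.FiniteType k (integralClosure B₀ E) :=
      Algebra.FiniteType.trans ‹Algebra.FiniteType k B₀› inferInstance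
    exact (Subalgebra.fg_iff_finiteType _).mpr this
  · exact integralClosure.isFractionRing_of_finite_extension (A := B₀) F E
  · intro y hy
    have hy : IsIntegral B₀ y := hy
    letI : Algebra B₀ O_E := ((algebraMap B₀ E).codRestrict O_E fun b => hB₀O b).toAlgebra
    haveI : IsScalarTower B₀ O_E E := IsScalarTower.of_algebraMap_eq fun _ => rfl
    have hy' : IsIntegral O_E y := hy.tower_top
    obtain ⟨z, rfl⟩ := IsIntegrallyClosed.algebraMap_eq_of_integral hy'
    exact z.2
  · intro y hy
    change IsIntegral B₀ y
    have hy' : IsIntegral (integralClosure B₀ E) y :=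
      isIntegral_of_subalgebra_le ((integralClosure B₀ E).restrictScalars k)
        ((integralClosure B₀ E).restrictScalars B₀) le_rfl hy
    exact isIntegral_trans y hy'


/-- Integrality over a subalgebra `S ⊆ K` (acting on `L ⊇ K`) is integrality over its image in
`L`. [folklore] -/
theorem isIntegral_map_iff {K L : Type u} [Field K] [Field L] [Algebra k K] [Algebra K L]
    [Algebra k L] [IsScalarTower k K L] (S : Subalgebra k K) (y : L) :
    IsIntegral (S.map (IsScalarTower.toAlgHom k K L)) y ↔ IsIntegral S y := by
  let T : Subalgebra k L := S.map (IsScalarTower.toAlgHom k K L)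
  let f : S →+* T := ((algebraMap K L).comp (algebraMap S K)).codRestrict T fun a => ⟨a, a.2, rfl⟩
  letI : Algebra S T := f.toAlgebra
  haveI : IsScalarTower S T L := IsScalarTower.of_algebraMap_eq fun _ => rfl
  haveI : Algebra.IsIntegral S T := ⟨fun t => by
    obtain ⟨_, ⟨a, ha, rfl⟩⟩ := t
    exact isIntegral_algebraMap (R := S) (A := T) (x := ⟨a, ha⟩)⟩
  exact ⟨fun h => isIntegral_trans y h, fun h => h.tower_top⟩


/-- Integrality over a subalgebra `S ⊆ K` (acting on `L ⊇ K`) is integrality over the subring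
image of `S` in `L`. [folklore] -/
theorem isIntegral_subringMap_iff {K L : Type u} [Field K] [Field L] [Algebra k K] [Algebra K L]
    [Algebra k L] [IsScalarTower k K L] (S : Subalgebra k K) (y : L) :
    IsIntegral (S.toSubring.map (algebraMap K L)) y ↔ IsIntegral S y := by
  let T : Subring L := S.toSubring.map (algebraMap K L)
  let f : S →+* T := ((algebraMap K L).comp (algebraMap S K)).codRestrict T fun a => ⟨a, a.2, rfl⟩
  letI : Algebra S T := f.toAlgebra
  haveI : IsScalarTower S T L := IsScalarTower.of_algebraMap_eq fun _ => rfl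
  haveI : Algebra.IsIntegral S T := ⟨fun t => by
    obtain ⟨_, ⟨a, ha, rfl⟩⟩ := t
    exact isIntegral_algebraMap (R := S) (A := T) (x := ⟨a, ha⟩)⟩
  exact ⟨fun h => isIntegral_trans y h, fun h => h.tower_top⟩


/-- **Residual algebraicity passes to a purely inseparable extension** (used tacitly in Temkin
2013, §4.2, Step 1 when `k̄, K` are replaced by `l, L`: the residue field of `L°₁` is purely
inseparable over that of `F°`, hence algebraic over the residues of `k̄`): if `L/K` is purely
inseparable, `OL₁ ∩ K = O₁`, and the residue field of `O₁` is algebraic over the residues of a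
subfield `E`, then the residue field of `OL₁` is algebraic over the residues of the image of `E`.
[folklore] -/
theorem isResiduallyAlgebraicOver_of_isPurelyInseparable {K L : Type u} [Field K] [Field L]
    [Algebra K L] [IsPurelyInseparable K L] (O₁ : ValuationSubring K) (OL₁ : ValuationSubring L)
    (hOL₁ : OL₁.comap (algebraMap K L) = O₁) (E : Subfield K)
    (hres : IsResiduallyAlgebraicOver O₁ E ⊤) :
    IsResiduallyAlgebraicOver OL₁ (E.map (algebraMap K L)) ⊤ := by
  -- the local inclusion `O₁ → OL₁` and the induced map of residue fields
  have hmem : ∀ z : O₁, algebraMap K L z ∈ OL₁ := fun z => by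
    have : (z : K) ∈ OL₁.comap (algebraMap K L) := by rw [hOL₁]; exact z.2
    exact this
  let ι : O₁ →+* OL₁ := ((algebraMap K L).comp O₁.subtype).codRestrict OL₁ hmem
  haveI : IsLocalHom ι := by
    refine ⟨fun z hz => ?_⟩
    by_cases hz0 : (z : K) = 0
    · exfalso
      apply hz.ne_zero
      exact Subtype.ext (by change algebraMap K L z = 0; rw [hz0, map_zero])
    have hzi : ((algebraMap K L z)⁻¹) ∈ OL₁ := inv_mem_of_isUnit OL₁ (hmem z) hz
    have hzi' : (z : K)⁻¹ ∈ O₁ := by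
      have h' : (z : K)⁻¹ ∈ OL₁.comap (algebraMap K L) := by
        rw [ValuationSubring.mem_comap, map_inv₀]; exact hzi
      rw [hOL₁] at h'
      exact h'
    exact isUnit_of_inv_mem O₁ z.2 hzi' hz0
  let ρ : ResidueField O₁ →+* ResidueField OL₁ := ResidueField.map ι
  have hρ : ∀ z : O₁, ρ (residue O₁ z) = residue OL₁ ⟨algebraMap K L z, hmem z⟩ := fun z =>
    ResidueField.map_residue ι z
  -- `ρ` maps the residues of `E` into the residues of `E.map`
  set E' : Subfield L := E.map (algebraMap K L) with hE'
  have hρE : ∀ r : resField O₁ E, ρ r ∈ resField OL₁ E' := by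
    rintro ⟨r, hr⟩
    obtain ⟨a, haE, rfl⟩ := (mem_resField_iff O₁ E r).mp hr
    rw [hρ]
    exact residue_mem_resField OL₁ _ ⟨a, haE, rfl⟩
  let f : resField O₁ E →+* resField OL₁ E' := (ρ.comp (resField O₁ E).subtype).codRestrict _ hρE
  have hcomm : (algebraMap (resField OL₁ E') (ResidueField OL₁)).comp f =
      ρ.comp (algebraMap (resField O₁ E) (ResidueField O₁)) := RingHom.ext fun _ => rfl
  -- now take any residue `r = residue y`
  intro r hr
  obtain ⟨y, -, rfl⟩ := (mem_resField_iff OL₁ ⊤ r).mp hr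
  obtain ⟨m, z, hz⟩ := IsPurelyInseparable.pow_mem K (ringExpChar K) (y : L)
  have hzO₁ : z ∈ O₁ := by
    rw [← hOL₁, ValuationSubring.mem_comap, hz]; exact pow_mem y.2 _
  have hpow : residue OL₁ y ^ ringExpChar K ^ m = ρ (residue O₁ ⟨z, hzO₁⟩) := by
    rw [hρ, ← map_pow]
    congr 1
    exact Subtype.ext hz.symm
  have halg : IsAlgebraic (resField O₁ E) (residue O₁ ⟨z, hzO₁⟩) :=
    hres _ (residue_mem_resField O₁ _ (Subfield.mem_top _))
  have halg' : IsAlgebraic (resField OL₁ E') (ρ (residue O₁ ⟨z, hzO₁⟩)) :=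
    halg.ringHom_of_comp_eq f ρ f.injective hcomm
  rw [← hpow] at halg'
  exact IsAlgebraic.of_pow (expChar_pow_pos K (ringExpChar K) m) halg'

end prelim

/-! ### Step 1 of §4.2: reduction to the normal form, and the induction step -/

section stepOne

/-- **Matsumura's Thm. 26.9 (algebraic case), DISCHARGED**: an algebraic field extension is
formally smooth iff it is separable — the named fact `Matsumura1987_26_9` holds, by
`Literature.FieldTheory.Separability.formallySmooth_iff_isSeparable_of_isAlgebraic` ("⇐" is
Mathlib's `Algebra.FormallyEtale.of_isSeparable`; "⇒" passes through the separable closure and a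
`p`-basis derivation obstruction). [cite: Matsumura1987, Thm. 26.9] -/
theorem Matsumura1987_26_9_holds : Matsumura1987_26_9.{u} := fun K L _ _ _ hKL =>
  haveI := hKL
  Literature.FieldTheory.Separability.formallySmooth_iff_isSeparable_of_isAlgebraic K L

-- `linter.deprecated` is switched off for the next declaration only (verdict clean-up
-- 2026-08-16): it names, as a hypothesis, the MIS-RENDERED fact `Temkin2013_Steps34`, deprecated
-- in `InseparableLocalUniformizationEngine.lean` in favour of the PROVED corrected rendering
-- `Temkin2013_Steps34_tower` / `Temkin2013_Steps34_tower_holds`; kept for its legacy users (see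
-- the module docstring, STATUS, for the unconditional counterparts).
set_option linter.deprecated false in
set_option maxHeartbeats 1600000 in
/-- **The induction step on the height** (Temkin 2013, §4.2, pp. 50–51), PROVED from the descent
theorem (`Temkin2013Descent` = Thm. 4.1.1), Lemma 3.3.2 in its corrected rendering
(`Temkin2013_Lemma332_nft`, `InseparableLocalUniformizationDecompletion.lean`), Steps 3–4 of
the proof of Thm. 4.1.1 (`Temkin2013_Steps34`), and Matsumura 26.9 (`Matsumura1987_26_9`, the
dictionary "simple = separable residue field = `0`-smooth"; discharged, see
`relHeightLE_succ_nft`): if the corrected relative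
Thm. 1.3.2 holds for valuation rings of height `≤ n`, it holds in height `≤ n + 1` (for every
`n`; the paper needs `n ≥ 1`, the case `n = 0` being covered by Thm. 4.1.1 directly).
Step 1 (reduction to the normal form of `relConclusion_of_normalForm`): choose the immediate
coarsening `F° = O₁` of `K° = O` (`exists_minimal_overring`), of height `≤ n`
(`ringKrullDim_le_of_lt`); the subfield `k̄ = k(b) ⊆ F°` with `F̃/k̄` algebraic
(`exists_intermediateField_valuation_eq_one_isResiduallyAlgebraicOver`); an affine model `Y` of
`k̄°` and a normal refinement of `X` over it; apply the induction hypothesis to the `k̄`-variety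
`X_η` and the valued field `F` of height `≤ n`; extend the resulting refinement of `X_η` to a
refinement of `X` (`exists_refinement_adjoin_eq`) and pass to `L`, `Nr_L(X)` (Step 0); then
Step 2 (`relConclusion_of_normalForm`) and the Step-0 transports
(`Temkin2013RelConclusion.of_purelyInseparable_right`, `.of_le`) conclude.
[cite: Temkin2013, Section 4.2 (arXiv:0804.1554v3 pp. 50–51)] -/
theorem relHeightLE_succ_nft_of_matsumura (h332 : Temkin2013_Lemma332_nft.{u})
    (h34 : Temkin2013_Steps34.{u}) (h269 : Matsumura1987_26_9.{u}) (hD : Temkin2013Descent.{u})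
    (n : ℕ) (IH : Temkin2013RelHeightLE.{u} n) : Temkin2013RelHeightLE.{u} (n + 1) := by
  intro k K _ _ _ hfg O hk hdim A hAO hAfg hAfr
  classical
  by_cases hle : ringKrullDim O ≤ n
  · exact IH k K hfg O hk hle A hAO hAfg hAfr
  -- `K°` has height exactly `n + 1 ≥ 2`; its immediate coarsening `F°`
  have hO : O ≠ ⊤ := valuationSubring_ne_top_of_not_ringKrullDim_le O n hle
  haveI := hAfr
  haveI : Finite {S : ValuationSubring K // O ≤ S} := finite_overrings_of_fg O hk A hAfg
  obtain ⟨O₁, hlt, -, himm⟩ := exists_minimal_overring O hO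
  have hdim' : ringKrullDim O ≤ (n + 1 : ℕ) := by exact_mod_cast hdim
  have hdimO₁ : ringKrullDim O₁ ≤ n := ringKrullDim_le_of_lt O O₁ hlt n hdim'
  have hk₁ : ∀ c : k, algebraMap k K c ∈ O₁ := fun c => hlt.le (hk c)
  -- the subfield `k̄ = k(b) ⊆ F°` with `F̃/k̄` algebraic
  obtain ⟨f, b, -, -, hkbFG, -, -, hkbO₁, hres⟩ :=
    exists_intermediateField_valuation_eq_one_isResiduallyAlgebraicOver k O₁ hk₁
      (trdeg_lt_aleph0_of_fg hfg)
  set kb : IntermediateField k K := IntermediateField.adjoin k (Set.range fun i => (b i : K))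
    with hkbdef
  have hkb : ∀ c : kb, (c : K) ∈ O₁ := fun c => hkbO₁ c c.2
  have hkbfg : (⊤ : IntermediateField k kb).FG := intermediateField_fg_top_of_fg kb hkbFG
  have hkbK : (⊤ : IntermediateField kb K).FG := intermediateField_fg_top_of_fg_top kb hfg
  set Okb : ValuationSubring kb := O.comap (algebraMap kb K) with hOkbdef
  have hkOkb : ∀ c : k, algebraMap k kb c ∈ Okb := fun c => by
    change algebraMap kb K (algebraMap k kb c) ∈ O
    rw [← IsScalarTower.algebraMap_apply]; exact hk c
  have hres' : IsResiduallyAlgebraicOver O₁ (algebraMap kb K).fieldRange ⊤ := by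
    rw [fieldRange_algebraMap_intermediateField]; exact hres
  have hdim1 : ringKrullDim Okb = 1 :=
    ringKrullDim_comap_eq_one O O₁ hlt.le (algebraMap kb K) hkb hlt.ne himm hres'
  -- an affine model `Y = Spec B₀` of `k̄°` and a normal refinement of `X` over it
  obtain ⟨B₀, hB₀O, hB₀fg, hB₀fr⟩ := exists_affineModel k kb hkbfg Okb hkOkb
  obtain ⟨tB, htB⟩ := hB₀fg
  obtain ⟨tA, htA⟩ := hAfg
  let Oalg : Subalgebra k K := { O.toSubring.toSubsemiring with algebraMap_mem' := hk }
  set A₀ : Subalgebra k K := Algebra.adjoin k (↑tA ∪ (algebraMap kb K) '' ↑tB) with hA₀def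
  have hAA₀ : A ≤ A₀ := by rw [← htA]; exact Algebra.adjoin_mono Set.subset_union_left
  have hA₀fg : A₀.FG := ⟨tA ∪ tB.image (algebraMap kb K), by
    rw [Finset.coe_union, Finset.coe_image]⟩
  have htAO : (tA : Set K) ⊆ O := fun y hy => hAO (htA ▸ Algebra.subset_adjoin hy :)
  have htBO : (algebraMap kb K) '' (tB : Set kb) ⊆ (O : Set K) := by
    rintro _ ⟨c, hc, rfl⟩
    exact hB₀O (htB ▸ Algebra.subset_adjoin hc :)
  have hA₀O : A₀.toSubring ≤ O.toSubring := by
    have : A₀ ≤ Oalg := Algebra.adjoin_le (Set.union_subset htAO htBO)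
    exact fun y hy => this hy
  have hA₀fr : IsFractionRing A₀ K := by
    refine IsFractionRing.of_field A₀ K fun z => ?_
    obtain ⟨a, c, -, rfl⟩ := IsFractionRing.div_surjective (A := A) z
    exact ⟨⟨a, hAA₀ a.2⟩, ⟨c, hAA₀ c.2⟩, rfl⟩
  obtain ⟨A₁, hA₀A₁, hA₁O, hA₁fg, hA₁fr, hA₁n, -⟩ := exists_normal_affineModel_ge' O A₀ hA₀O hA₀fg hA₀fr
  have hAA₁ : A ≤ A₁ := hAA₀.trans hA₀A₁
  have hB₀A₁ : ∀ c : B₀, algebraMap kb K c ∈ A₁ := fun c => by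
    have hc : (c : kb) ∈ Algebra.adjoin k (tB : Set kb) := by rw [htB]; exact c.2
    have : Algebra.adjoin k (tB : Set kb) ≤ A₁.comap (IsScalarTower.toAlgHom k kb K) :=
      Algebra.adjoin_le fun y hy => hA₀A₁ (Algebra.subset_adjoin (Or.inr ⟨y, hy, rfl⟩))
    exact this hc
  -- the generic fibre `X_η = Spec k̄[A₁]` and the induction hypothesis for `F`
  set Aη : Subalgebra kb K := Algebra.adjoin kb (A₁ : Set K) with hAηdef
  have hAη : Aη.toSubring ≤ O₁.toSubring :=
    adjoin_toSubring_le_valuationSubring kb O₁ hkb _ fun y hy => hlt.le (hA₁O hy)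
  obtain ⟨hAηfg, hAηfr⟩ := adjoin_fg_and_isFractionRing kb A₁ hA₁fg hA₁fr
  obtain ⟨L, iF, iKL, ikbL, iT, hLfin, hLpi, l, hlfin, hlpi, Aη', hAηAη', hAη'O₁, hAη'fg, hAη'fr,
    OL₁, hOL₁, Nη, hNη, hNηint, hNηfg, hNηfr, hsm, hsep, hreg⟩ :=
    IH kb K hkbK O₁ hkb hdimO₁ Aη hAη hAηfg hAηfr
  -- the `k̄`-structure on `L` provided by the induction hypothesis is the canonical one
  have hikbL : ikbL = (IntermediateField.instAlgebraSubtypeMem kb : Algebra kb L) :=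
    Algebra.algebra_ext _ _ fun c => @IsScalarTower.algebraMap_apply kb K L _ _ _ _ _ ikbL iT c
  subst hikbL
  -- ground-field structure on `L`, the valuation ring `L° = OL` over `K°`, the coarsening `OL₁`
  letI ikL : Algebra k L := ((algebraMap K L).comp (algebraMap k K)).toAlgebra
  haveI : IsScalarTower k K L := IsScalarTower.of_algebraMap_eq fun _ => rfl
  haveI : IsScalarTower k kb L := IsScalarTower.of_algebraMap_eq fun c => by
    change algebraMap K L (algebraMap k K c) = algebraMap K L ((algebraMap k kb c : kb) : K)
    rw [IsScalarTower.algebraMap_apply k kb K]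
    rfl
  haveI := hLfin
  haveI := hLpi
  obtain ⟨OL, hOL⟩ := exists_valuationSubring_comap_eq (Ω := L) O
  have hOLle : OL ≤ OL₁ :=
    valuationSubring_le_of_comap_le_of_isPurelyInseparable (K := K) (by rw [hOL, hOL₁]; exact hlt.le)
  have hOLne : OL ≠ OL₁ := fun heq => hlt.ne (by rw [← hOL, ← hOL₁, heq])
  have hkL : ∀ c : k, algebraMap k L c ∈ OL := fun c => by
    have : algebraMap k K c ∈ OL.comap (algebraMap K L) := by rw [hOL]; exact hk c
    exact this
  have hdimL : ringKrullDim OL ≤ n + 1 := by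
    rw [ringKrullDim_eq_comap_of_isPurelyInseparable (K := K) OL, hOL]; exact hdim
  have hfgL : (⊤ : IntermediateField k L).FG := by
    haveI : Algebra.EssFiniteType k K := IntermediateField.fg_top_iff.mp hfg
    haveI : Algebra.EssFiniteType K L := inferInstance
    haveI : Algebra.EssFiniteType k L := Algebra.EssFiniteType.comp k K L
    exact IntermediateField.fg_top_iff.mpr ‹_›
  -- the new base field `l ⊇ k̄` over `k` and its valuation ring `l° = L° ∩ l` of height one
  haveI : Algebra.EssFiniteType k kb := IntermediateField.fg_top_iff.mp hkbfg
  haveI : Module.Finite kb l := hlfin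
  have hlfgk : (⊤ : IntermediateField k (l.restrictScalars k)).FG := by
    haveI : Algebra.EssFiniteType kb l := inferInstance
    haveI h3 : Algebra.EssFiniteType k l := Algebra.EssFiniteType.comp k kb l
    exact IntermediateField.fg_top_iff.mpr h3
  set Ol : ValuationSubring l := OL.comap (algebraMap l L) with hOldef
  have hOlcomap : Ol.comap (algebraMap kb l) = Okb := by
    ext c
    change algebraMap l L (algebraMap kb l c) ∈ OL ↔ algebraMap kb K c ∈ O
    rw [← IsScalarTower.algebraMap_apply kb l L, IsScalarTower.algebraMap_apply kb K L,
      ← ValuationSubring.mem_comap, hOL]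
  have hdim1l : ringKrullDim Ol = 1 := by
    haveI : IsPurelyInseparable kb l := hlpi
    rw [ringKrullDim_eq_comap_of_isPurelyInseparable (K := kb) Ol, hOlcomap, hdim1]
  -- `A₂`: a refinement of `X` with generic fibre `A′_η` (Step 1, "extended to a refinement of X")
  obtain ⟨A₂, hA₁A₂, hA₂O, hA₂fg, hadj₂⟩ :=
    exists_refinement_adjoin_eq O O₁ hlt.le hk kb hres A₁ hA₁O hA₁fg Aη' hAη'O₁ hAη'fg hAηAη'
  have hAA₂ : A ≤ A₂ := hAA₁.trans hA₁A₂
  have hA₂fr : IsFractionRing A₂ K := by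
    refine IsFractionRing.of_field A₂ K fun z => ?_
    obtain ⟨a, c, -, rfl⟩ := IsFractionRing.div_surjective (A := A) z
    exact ⟨⟨a, hAA₂ a.2⟩, ⟨c, hAA₂ c.2⟩, rfl⟩
  have hB₀A₂ : ∀ c : B₀, algebraMap kb K c ∈ A₂ := fun c => hA₁A₂ (hB₀A₁ c)
  -- `A′ = Nr_L(A₂)` and `B′ = Nr_l(B₀)` ("replace `k̄, K, X` and `Y` with `l, L, Nr_L(X)` and `Nr_l(Y)`")
  have hA₂OL : ∀ a : A₂, algebraMap K L a ∈ OL := fun a => by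
    have : (a : K) ∈ OL.comap (algebraMap K L) := by rw [hOL]; exact hA₂O a.2
    exact this
  obtain ⟨A', hA'fg, hA'fr, hA'O, hmemA', hA'n⟩ :=
    exists_integralClosure_model (k := k) OL A₂ hA₂OL hA₂fg hA₂fr
  have hB₀Ol : ∀ b : B₀, algebraMap kb l b ∈ Ol := fun b => by
    change algebraMap l L (algebraMap kb l b) ∈ OL
    rw [← IsScalarTower.algebraMap_apply kb l L, IsScalarTower.algebraMap_apply kb K L]
    have : algebraMap kb K b ∈ OL.comap (algebraMap K L) := by
      rw [hOL]; exact hB₀O b.2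
    exact this
  obtain ⟨B', hB'fg, hB'fr, hB'O, hmemB', -⟩ :=
    exists_integralClosure_model (k := k) Ol B₀ hB₀Ol ⟨tB, htB⟩ hB₀fr
  -- `B′ ⊆ A′`
  have hB'A' : ∀ b : B', algebraMap l L b ∈ A' := fun b => by
    rw [hmemA']
    have hb : IsIntegral B₀ (b : l) := (hmemB' _).mp b.2
    have hb' : IsIntegral B₀ (algebraMap l L b) := hb.map (IsScalarTower.toAlgHom B₀ l L)
    -- `B₀ → A₂ → L`
    letI : Algebra B₀ A₂ := ((algebraMap kb K).comp (algebraMap B₀ kb)).codRestrict A₂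
      (fun c => hB₀A₂ c) |>.toAlgebra
    haveI : IsScalarTower B₀ A₂ L := IsScalarTower.of_algebraMap_eq fun c => by
      change algebraMap kb L (c : kb) = algebraMap K L (algebraMap kb K (c : kb))
      exact IsScalarTower.algebraMap_apply kb K L _
    exact hb'.tower_top
  -- the generic fibre of `Nr_L(A₂)` over `l` is `N_η = Nr_L(A′_η)` (Step 1, last sentence)
  have hB₀' : ∀ z : kb, ∃ a ∈ B₀.toSubring, ∃ c ∈ B₀.toSubring, z = a / c := fun z => by
    obtain ⟨a, c, -, rfl⟩ := IsFractionRing.div_surjective (A := B₀) z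
    exact ⟨a, a.2, c, c.2, rfl⟩
  have hB₀A₂' : B₀.toSubring.map (algebraMap kb K) ≤ A₂.toSubring := by
    rintro _ ⟨c, hc, rfl⟩; exact hB₀A₂ ⟨c, hc⟩
  have hNηeq : Algebra.adjoin l (A' : Set L) = Nη := by
    refine le_antisymm (Algebra.adjoin_le fun y hy => ?_) fun y hy => ?_
    · -- `A′ ⊆ N_η`: integral over `A₂`, hence over `A′_η ⊇ A₂`
      change y ∈ (Nη : Set L)
      rw [hNηint]
      change IsIntegral (Aη'.map (IsScalarTower.toAlgHom kb K L)) y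
      rw [isIntegral_map_iff]
      have hy' : IsIntegral A₂ y := (hmemA' y).mp hy
      letI : Algebra A₂ Aη' := (A₂.val.toRingHom.codRestrict Aη'.toSubring fun a => by
        rw [← hadj₂]; exact Algebra.subset_adjoin a.2).toAlgebra
      haveI : IsScalarTower A₂ Aη' L := IsScalarTower.of_algebraMap_eq fun _ => rfl
      exact hy'.tower_top
    · -- `N_η ⊆ l[A′]`: `y` integral over `k̄[A₂]`, so `b y ∈ Nr_L(A₂)` for some `0 ≠ b ∈ B₀`
      have hy' : IsIntegral ((Algebra.adjoin kb (A₂ : Set K)).map (IsScalarTower.toAlgHom kb K L)) y := by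
        rw [hadj₂]
        have : y ∈ (Nη : Set L) := hy
        rw [hNηint] at this
        exact this
      obtain ⟨b, hb, hb0, hby⟩ :=
        exists_mul_isIntegral_of_isIntegral_map_adjoin B₀.toSubring hB₀' A₂.toSubring hB₀A₂' hy'
      have hbyA' : algebraMap kb L b * y ∈ A' := by
        rw [hmemA', ← isIntegral_subringMap_iff (k := k)]
        exact hby
      have hbl : algebraMap kb L b = algebraMap l L (algebraMap kb l b) :=
        IsScalarTower.algebraMap_apply kb l L b
      have hc0 : algebraMap l L (algebraMap kb l b) ≠ 0 := by
        rw [← hbl]; exact (map_ne_zero _).mpr hb0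
      have : y = algebraMap l L (algebraMap kb l b)⁻¹ * (algebraMap kb L b * y) := by
        rw [hbl, map_inv₀, ← mul_assoc, inv_mul_cancel₀ hc0, one_mul]
      rw [this]
      exact Subalgebra.mul_mem _ (Subalgebra.algebraMap_mem _ _) (Algebra.subset_adjoin hbyA')
  subst hNηeq
  -- `k(𝔭)` is integral over `l` (closedness of the centre in the new configuration)
  have hresL : IsResiduallyAlgebraicOver OL₁ (kb.toSubfield.map (algebraMap K L)) ⊤ :=
    isResiduallyAlgebraicOver_of_isPurelyInseparable O₁ OL₁ hOL₁ kb.toSubfield hres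
  have hkbl : kb.toSubfield.map (algebraMap K L) ≤ (l.restrictScalars k).toSubfield := by
    rintro _ ⟨c, hc, rfl⟩
    have : algebraMap kb L ⟨c, hc⟩ ∈ l := l.algebraMap_mem ⟨c, hc⟩
    exact this
  have hresl : IsResiduallyAlgebraicOver OL₁ (l.restrictScalars k).toSubfield ⊤ := fun r hr =>
    isAlgebraic_of_subfield_le (resField_mono OL₁ hkbl) (hresL r hr)
  have hkbOL₁ : ∀ c : kb, algebraMap kb L c ∈ OL₁ := fun c => by
    have : algebraMap kb K c ∈ OL₁.comap (algebraMap K L) := by rw [hOL₁]; exact hkb c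
    rw [IsScalarTower.algebraMap_apply kb K L]; exact this
  have hlOL₁ : ∀ c : (l.restrictScalars k), (c : L) ∈ OL₁ := fun c => by
    have hc : (c : L) ∈ l := c.2
    haveI : Algebra.IsIntegral kb l := Algebra.IsIntegral.of_finite kb l
    have hint : IsIntegral kb (⟨(c : L), hc⟩ : l) := Algebra.IsIntegral.isIntegral _
    have hint' : IsIntegral kb (c : L) := hint.map (IsScalarTower.toAlgHom kb l L)
    letI : Algebra kb OL₁ := ((algebraMap kb L).codRestrict OL₁ hkbOL₁).toAlgebra
    haveI : IsScalarTower kb OL₁ L := IsScalarTower.of_algebraMap_eq fun _ => rfl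
    have h2 : IsIntegral OL₁ (c : L) := hint'.tower_top
    obtain ⟨w, hw⟩ := IsIntegrallyClosed.algebraMap_eq_of_integral h2
    rw [← hw]; exact w.2
  -- switch to `l` viewed as an intermediate field of `L/k`
  set kb' : IntermediateField k L := l.restrictScalars k with hkb'def
  have hNη' : (Algebra.adjoin kb' (A' : Set L)).toSubring ≤ OL₁.toSubring := hNη
  have hint' : Algebra.IsIntegral kb'
      (↥(Algebra.adjoin kb' (A' : Set L)) ⧸ centreIdeal (Algebra.adjoin kb' (A' : Set L)) OL₁ hNη') :=
    algebra_isIntegral_quot_centreIdeal OL₁ kb' (Algebra.adjoin kb' (A' : Set L)) hNη' hlOL₁ hresl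
  have hsm' : Algebra.IsSmoothAt kb' (centreIdeal (Algebra.adjoin kb' (A' : Set L)) OL₁ hNη') := hsm
  -- simplicity: `k(𝔭)/l` is algebraic and `0`-smooth, hence separable (Matsumura 26.9)
  set N' : Subalgebra kb' L := Algebra.adjoin kb' (A' : Set L) with hN'def
  set 𝔭 : Ideal N' := centreIdeal N' OL₁ hNη' with h𝔭def
  haveI : Algebra.IsIntegral kb' (N' ⧸ 𝔭) := hint'
  haveI h𝔭max : 𝔭.IsMaximal := Ideal.Quotient.maximal_of_isField _
    (isField_of_isIntegral_of_isField' (R := kb') (S := N' ⧸ 𝔭) (Field.toIsField kb'))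
  letI : Field (N' ⧸ 𝔭) := Ideal.Quotient.field 𝔭
  have hsep' : Algebra.IsSeparable kb' (N' ⧸ 𝔭) := by
    let Rp := Localization.AtPrime 𝔭
    let e₀ : N' ⧸ 𝔭 ≃+* ResidueField Rp := IsLocalization.AtPrime.equivQuotMaximalIdeal 𝔭 Rp
    have he₀ : ∀ c : kb', e₀ (algebraMap kb' (N' ⧸ 𝔭) c) = algebraMap kb' (ResidueField Rp) c := by
      intro c
      change IsLocalization.AtPrime.equivQuotMaximalIdeal 𝔭 Rp
        (Ideal.Quotient.mk 𝔭 (algebraMap kb' N' c)) = _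
      rw [IsLocalization.AtPrime.equivQuotMaximalIdeal_apply_mk]
      change Ideal.Quotient.mk _ (algebraMap N' Rp (algebraMap kb' N' c)) =
        IsLocalRing.residue Rp (algebraMap kb' Rp c)
      rw [IsScalarTower.algebraMap_apply kb' N' Rp]
      rfl
    let e : (N' ⧸ 𝔭) ≃ₐ[kb'] ResidueField Rp := AlgEquiv.ofRingEquiv (f := e₀) he₀
    haveI : Algebra.IsAlgebraic kb' (N' ⧸ 𝔭) := Algebra.IsIntegral.isAlgebraic
    haveI : Algebra.IsAlgebraic kb' (ResidueField Rp) := e.isAlgebraic_iff.mp ‹_›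
    have hsm0 : Algebra.FormallySmooth kb' (ResidueField Rp) := hsep
    haveI : Algebra.IsSeparable kb' (ResidueField Rp) := (h269 kb' (ResidueField Rp) ‹_›).mp hsm0
    exact AlgEquiv.Algebra.isSeparable e.symm
  -- Step 2 in the new configuration, and the Step-0 transports back to `(k, K, K°, X)`
  let B'' : Subalgebra k kb' := B'
  have hB'O' : B''.toSubring ≤ (OL.comap (algebraMap kb' L)).toSubring := hB'O
  have hB'fg' : B''.FG := hB'fg
  have hB'fr' : IsFractionRing B'' kb' := hB'fr
  have hB'A'' : ∀ b : B'', algebraMap kb' L b ∈ A' := hB'A'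
  have hdim1' : ringKrullDim (OL.comap (algebraMap kb' L)) = 1 := hdim1l
  have hconclL : Temkin2013RelConclusion k L OL A' :=
    relConclusion_of_normalForm_nft h332 h34 hD hfgL OL hkL OL₁ hOLle kb' hlfgk hdim1' B'' hB'O'
      hB'fg' hB'fr' A' hA'O hA'fg hA'fr hA'n hB'A'' hNη' hint' hsm' hsep'
  have hA₂A'' : ∀ a ∈ A₂, algebraMap K L a ∈ A' := fun a ha =>
    (hmemA' _).mpr (isIntegral_algebraMap (R := A₂) (x := ⟨a, ha⟩))
  have hconclK : Temkin2013RelConclusion k K O A₂ :=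
    Temkin2013RelConclusion.of_purelyInseparable_right O A₂ hA₂fg hA₂fr L OL hOL A' hA₂A'' hconclL
  exact Temkin2013RelConclusion.of_le O hAA₂ hconclK

-- `linter.deprecated` off for the next declaration only (same reason: its hypothesis is the
-- deprecated `Temkin2013_Steps34`; see the first such switch in this file).
set_option linter.deprecated false in
/-- **The induction step on the height from the corrected Lemma 3.3.2** (Temkin 2013, §4.2),
with Matsumura's Thm. 26.9 discharged (`Matsumura1987_26_9_holds`): the corrected relative
Thm. 1.3.2 in height `≤ n` implies it in height `≤ n + 1`, given Thm. 4.1.1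
(`Temkin2013Descent`), Lemma 3.3.2 (`Temkin2013_Lemma332_nft`) and Steps 3–4 of the proof of
Thm. 4.1.1 (`Temkin2013_Steps34`). [cite: Temkin2013, Section 4.2 (arXiv:0804.1554v3 pp. 50–51)] -/
theorem relHeightLE_succ_nft (h332 : Temkin2013_Lemma332_nft.{u}) (h34 : Temkin2013_Steps34.{u})
    (hD : Temkin2013Descent.{u}) (n : ℕ) (IH : Temkin2013RelHeightLE.{u} n) :
    Temkin2013RelHeightLE.{u} (n + 1) :=
  relHeightLE_succ_nft_of_matsumura h332 h34 Matsumura1987_26_9_holds hD n IH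

-- `linter.deprecated` off for the next declaration only (same reason: its hypothesis is the
-- deprecated `Temkin2013_Steps34`; see the first such switch in this file).
set_option linter.deprecated false in
/-- The induction step with Lemma 3.3.2 taken in the tree's OLDER rendering
`Temkin2013_Lemma332` (refutable: it lacks the printed "normalized finite type" hypothesis; see
`InseparableLocalUniformizationDecompletion.lean`), kept with its original signature; it is the
special case `Temkin2013_Lemma332_nft.of_lemma332` of `relHeightLE_succ_nft_of_matsumura` and
should not be used as genuine input. [cite: Temkin2013, Section 4.2 (arXiv:0804.1554v3 pp. 50–51)] -/
theorem relHeightLE_succ (h332 : Temkin2013_Lemma332.{u}) (h34 : Temkin2013_Steps34.{u})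
    (h269 : Matsumura1987_26_9.{u}) (hD : Temkin2013Descent.{u}) (n : ℕ)
    (IH : Temkin2013RelHeightLE.{u} n) : Temkin2013RelHeightLE.{u} (n + 1) :=
  relHeightLE_succ_nft_of_matsumura (Temkin2013_Lemma332_nft.of_lemma332 h332) h34 h269 hD n IH

end stepOne

/-! ### The packaged §4.2 fact and the frontier of Thm. 1.3.2 -/

-- `linter.deprecated` off for the next declaration only (same reason: its hypothesis is the
-- deprecated `Temkin2013_Steps34`; see the first such switch in this file).
set_option linter.deprecated false in
/-- **`Temkin2013HeightStepOfDescent` from its printed inputs**: §4.2 of Temkin 2013 (the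
induction on the height, pp. 50–51) follows from Thm. 4.1.1 (its hypothesis), Lemma 3.3.2, Steps
3–4 of the proof of Thm. 4.1.1, and Matsumura's Thm. 26.9. PROVED (`relHeightLE_succ`).
[cite: Temkin2013, Section 4.2 (arXiv:0804.1554v3 pp. 50–51)] -/
theorem Temkin2013HeightStepOfDescent.of_lemma332_steps34 (h332 : Temkin2013_Lemma332.{u})
    (h34 : Temkin2013_Steps34.{u}) (h269 : Matsumura1987_26_9.{u}) :
    Temkin2013HeightStepOfDescent.{u} :=
  fun hD n _ IH => relHeightLE_succ h332 h34 h269 hD n IH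

-- `linter.deprecated` off for the next declaration only (same reason: its hypothesis is the
-- deprecated `Temkin2013_Steps34`; see the first such switch in this file).
set_option linter.deprecated false in
/-- The induction step without its descent input, from the descent theorem and the printed
inputs of §4.2. [cite: Temkin2013, Section 4.2 (arXiv:0804.1554v3 pp. 50–51)] -/
theorem Temkin2013HeightStep.of_descent_lemma332_steps34 (hD : Temkin2013Descent.{u})
    (h332 : Temkin2013_Lemma332.{u}) (h34 : Temkin2013_Steps34.{u})
    (h269 : Matsumura1987_26_9.{u}) : Temkin2013HeightStep.{u} :=
  fun n _ IH => relHeightLE_succ h332 h34 h269 hD n IH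

-- `linter.deprecated` off for the next declaration only (same reason: its hypothesis is the
-- deprecated `Temkin2013_Steps34`; see the first such switch in this file).
set_option linter.deprecated false in
/-- **The corrected relative Thm. 1.3.2 from Thm. 4.1.1 and the printed inputs of §4.2**
(Lemma 3.3.2, Steps 3–4 of the proof of Thm. 4.1.1, Matsumura 26.9).
[cite: Temkin2013, Thm. 1.3.2 via Sections 4.1–4.2] -/
theorem Temkin2013Relative.of_descent_printed (hD : Temkin2013Descent.{u})
    (h332 : Temkin2013_Lemma332.{u}) (h34 : Temkin2013_Steps34.{u})
    (h269 : Matsumura1987_26_9.{u}) : Temkin2013Relative.{u} :=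
  Temkin2013Relative.of_frontier hD
    (Temkin2013HeightStepOfDescent.of_lemma332_steps34 h332 h34 h269)

-- `linter.deprecated` off for the next declaration only (same reason: its hypothesis is the
-- deprecated `Temkin2013_Steps34`; see the first such switch in this file).
set_option linter.deprecated false in
/-- **The frontier of the corrected Thm. 1.3.2 after this file**: Thm. 5.5.2 (i)
(`Temkin2013Abhyankar`, logarithmic/toroidal geometry), Steps 1–4 of the proof of Thm. 4.1.1
(`Temkin2013DescentDefectStep`, resting on Thm. 3.3.1), Lemma 3.3.2, Steps 3–4 of the proof of
Thm. 4.1.1 (`Temkin2013_Steps34`), and Matsumura 26.9.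
[cite: Temkin2013, Thm. 1.3.2 via Sections 4.1–4.2 and 5.5] -/
theorem Temkin2013Relative.of_printed_frontier (hA : Temkin2013Abhyankar.{u})
    (hstep : Temkin2013DescentDefectStep.{u}) (h332 : Temkin2013_Lemma332.{u})
    (h34 : Temkin2013_Steps34.{u}) (h269 : Matsumura1987_26_9.{u}) : Temkin2013Relative.{u} :=
  Temkin2013Relative.of_abhyankar_frontier hA hstep
    (Temkin2013HeightStepOfDescent.of_lemma332_steps34 h332 h34 h269)

-- `linter.deprecated` off for the next declaration only (same reason: its hypothesis is the
-- deprecated `Temkin2013_Steps34`; see the first such switch in this file).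
set_option linter.deprecated false in
/-- The weak absolute form `Temkin2013` from the same frontier. [folklore] -/
theorem Temkin2013.of_printed_frontier (hA : Temkin2013Abhyankar.{u})
    (hstep : Temkin2013DescentDefectStep.{u}) (h332 : Temkin2013_Lemma332.{u})
    (h34 : Temkin2013_Steps34.{u}) (h269 : Matsumura1987_26_9.{u}) : Temkin2013.{u} :=
  (Temkin2013Relative.of_printed_frontier hA hstep h332 h34 h269).temkin2013

/-! ### The same layer against the corrected Lemma 3.3.2, Matsumura 26.9 discharged -/

-- `linter.deprecated` off for the next declaration only (same reason: its hypothesis is the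
-- deprecated `Temkin2013_Steps34`; see the first such switch in this file).
set_option linter.deprecated false in
/-- **`Temkin2013HeightStepOfDescent` from its printed inputs, corrected rendering**: §4.2 of
Temkin 2013 follows from Thm. 4.1.1 (its hypothesis), Lemma 3.3.2 (`Temkin2013_Lemma332_nft`)
and Steps 3–4 of the proof of Thm. 4.1.1; Matsumura 26.9 is discharged. PROVED
(`relHeightLE_succ_nft`). [cite: Temkin2013, Section 4.2 (arXiv:0804.1554v3 pp. 50–51)] -/
theorem Temkin2013HeightStepOfDescent.of_lemma332nft_steps34 (h332 : Temkin2013_Lemma332_nft.{u})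
    (h34 : Temkin2013_Steps34.{u}) : Temkin2013HeightStepOfDescent.{u} :=
  fun hD n _ IH => relHeightLE_succ_nft h332 h34 hD n IH

-- `linter.deprecated` off for the next declaration only (same reason: its hypothesis is the
-- deprecated `Temkin2013_Steps34`; see the first such switch in this file).
set_option linter.deprecated false in
/-- The packaged §4.2 fact from the OLD rendering of Lemma 3.3.2 no longer needs the Matsumura
hypothesis either. [cite: Temkin2013, Section 4.2 (arXiv:0804.1554v3 pp. 50–51)] -/
theorem Temkin2013HeightStepOfDescent.of_lemma332_steps34' (h332 : Temkin2013_Lemma332.{u})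
    (h34 : Temkin2013_Steps34.{u}) : Temkin2013HeightStepOfDescent.{u} :=
  Temkin2013HeightStepOfDescent.of_lemma332nft_steps34 (Temkin2013_Lemma332_nft.of_lemma332 h332) h34

-- `linter.deprecated` off for the next declaration only (same reason: its hypothesis is the
-- deprecated `Temkin2013_Steps34`; see the first such switch in this file).
set_option linter.deprecated false in
/-- The induction step on the height without its descent input, corrected rendering of
Lemma 3.3.2, Matsumura 26.9 discharged. [cite: Temkin2013, Section 4.2 (arXiv:0804.1554v3 pp. 50–51)] -/
theorem Temkin2013HeightStep.of_descent_lemma332nft_steps34 (hD : Temkin2013Descent.{u})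
    (h332 : Temkin2013_Lemma332_nft.{u}) (h34 : Temkin2013_Steps34.{u}) :
    Temkin2013HeightStep.{u} :=
  fun n _ IH => relHeightLE_succ_nft h332 h34 hD n IH

-- `linter.deprecated` off for the next declaration only (same reason: its hypothesis is the
-- deprecated `Temkin2013_Steps34`; see the first such switch in this file).
set_option linter.deprecated false in
/-- **The corrected relative Thm. 1.3.2 from Thm. 4.1.1, the corrected Lemma 3.3.2 and Steps 3–4
of the proof of Thm. 4.1.1.** [cite: Temkin2013, Thm. 1.3.2 via Sections 4.1–4.2] -/
theorem Temkin2013Relative.of_descent_nft (hD : Temkin2013Descent.{u})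
    (h332 : Temkin2013_Lemma332_nft.{u}) (h34 : Temkin2013_Steps34.{u}) :
    Temkin2013Relative.{u} :=
  Temkin2013Relative.of_frontier hD (Temkin2013HeightStepOfDescent.of_lemma332nft_steps34 h332 h34)

-- `linter.deprecated` off for the next declaration only (same reason: its hypothesis is the
-- deprecated `Temkin2013_Steps34`; see the first such switch in this file).
set_option linter.deprecated false in
/-- **The frontier of the corrected Thm. 1.3.2 after this file (corrected renderings only)**:
Thm. 5.5.2 (i) (`Temkin2013Abhyankar`, logarithmic/toroidal geometry of Abhyankar valuations),
Steps 1–4 of the proof of Thm. 4.1.1 (`Temkin2013DescentDefectStep`, resting on the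
Berkovich-analytic Thm. 3.3.1), Lemma 3.3.2 (`Temkin2013_Lemma332_nft`, decompletion) and Steps
3–4 of the proof of Thm. 4.1.1 (`Temkin2013_Steps34`, smooth-equivalence Lemmas 2.8.4/2.8.5);
no dictionary hypothesis. [cite: Temkin2013, Thm. 1.3.2 via Sections 4.1–4.2 and 5.5] -/
theorem Temkin2013Relative.of_nft_frontier (hA : Temkin2013Abhyankar.{u})
    (hstep : Temkin2013DescentDefectStep.{u}) (h332 : Temkin2013_Lemma332_nft.{u})
    (h34 : Temkin2013_Steps34.{u}) : Temkin2013Relative.{u} :=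
  Temkin2013Relative.of_abhyankar_frontier hA hstep
    (Temkin2013HeightStepOfDescent.of_lemma332nft_steps34 h332 h34)

-- `linter.deprecated` off for the next declaration only (same reason: its hypothesis is the
-- deprecated `Temkin2013_Steps34`; see the first such switch in this file).
set_option linter.deprecated false in
/-- **The weak absolute form `Temkin2013` (the fact used by the routes) from the corrected
frontier** `{Temkin2013Abhyankar, Temkin2013DescentDefectStep, Temkin2013_Lemma332_nft,
Temkin2013_Steps34}`. [cite: Temkin2013, Thm. 1.3.2] -/
theorem Temkin2013.of_nft_frontier (hA : Temkin2013Abhyankar.{u})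
    (hstep : Temkin2013DescentDefectStep.{u}) (h332 : Temkin2013_Lemma332_nft.{u})
    (h34 : Temkin2013_Steps34.{u}) : Temkin2013.{u} :=
  (Temkin2013Relative.of_nft_frontier hA hstep h332 h34).temkin2013

-- `linter.deprecated` off for the next declaration only (same reason: its hypothesis is the
-- deprecated `Temkin2013_Steps34`; see the first such switch in this file).
set_option linter.deprecated false in
/-- The height-`≤ 1` named fact `Temkin2013HeightLeOne` and the corrected frontier also give the
original two-fact frontier `{Temkin2013HeightLeOne, Temkin2013HeightStep}` of
`InseparableLocalUniformization.lean` its second member. [folklore] -/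
theorem Temkin2013HeightStep.of_nft_frontier (hA : Temkin2013Abhyankar.{u})
    (hstep : Temkin2013DescentDefectStep.{u}) (h332 : Temkin2013_Lemma332_nft.{u})
    (h34 : Temkin2013_Steps34.{u}) : Temkin2013HeightStep.{u} :=
  Temkin2013HeightStep.of_descent_lemma332nft_steps34
    (Temkin2013Descent.of_defect hA.descentAbhyankar hstep) h332 h34

end Literature.AlgebraicGeometry.Resolution
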